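import Mathlib
import Summits.Ventures.HodgeRepro2.T5DistributionMeasure
import Summits.Ventures.HodgeRepro2.T5AmiceRingEquiv
import Summits.Ventures.HodgeRepro2.T5AmiceDirac

/-!
# T5IwasawaLimit — «W[[Γ_𝔭]] ≅ W[[T]] (γ₀ ↦ 1 + T)» with W[[Γ_𝔭]] in its PRINTED meaning:
the inverse limit lim_k W[ℤ/p^k]

Tier-5 support for route-3's §G (route/T5-CHECK-G-p7.md §3 S5, §21.4): S5 reads the 𝔭-line measure
as «m ∈ W[[Γ_𝔭]] ≅ W[[T]] (γ₀ ↦ 1 + T)», where W[[Γ_𝔭]] = lim_k W[Γ_𝔭/Γ_𝔭^{p^k}] is the completed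
group ring.  The kernel record had this isomorphism for the MODEL's W[[Γ_𝔭]] — the bounded
functionals on C(ℤ_p, W) with convolution (T5AmiceRingEquiv, p401503: `amiceRingEquiv`).  With
T5MeasureDistribution / T5DistributionMeasure (a bounded functional ↔ a bounded compatible system
of values on the residue classes) this file writes the inverse limit itself:

* `iwasawaLimit p A` — the additive group of bounded compatible systems `(v k : ℤ/p^k → A)_k`
  (`IsCompat`: v k a = Σ_{b ≡ a} v (k+1) b), i.e. the bounded part of lim_k A[ℤ/p^k] (a group-ring
  element Σ_a v k a·[a] at each level);
* **`distAddEquiv : BoundedMeasure p A ≃+ iwasawaLimit p A`** (m ↦ its values on the residue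
  classes; inverse = the Riemann-sum measure) and
  **`iwasawaAmice : iwasawaLimit p A ≃+ boundedSeries A`** — the Iwasawa isomorphism, with
  **`iwasawaAmice_gamma`**: the topological generator γ₀ = (1 mod p^k)_k ↦ 1 + T;
* for a discrete valuation ring with a valuation-compatible norm (W): every compatible system is
  bounded and every power series is bounded (`mem_iwasawaLimit_iff_of_normDict`,
  `boundedSeries_eq_top_of_normDict`), so **`iwasawaAmiceDVR : iwasawaLimit p A ≃+ PowerSeries A`** —
  «W[[Γ_𝔭]] ≅ W[[T]]» as additive groups, the group ring side being the inverse limit as printed.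

What is NOT here: the multiplicative structure of the inverse limit (the group-ring product at each
level) and its compatibility with convolution — the record's ring isomorphism (p401503) is for the
model's side only; here the identification is additive (and as sets).

No printed input is consumed.  §8(d): uses an L-value-free non-vanishing device: NO.
-/

namespace Summit.Ventures.HodgeRepro2.T5IwasawaLimit

open Summit.Ventures.HodgeRepro2.T5MeasureDistribution
open Summit.Ventures.HodgeRepro2.T5DistributionMeasure
open Summit.Ventures.HodgeRepro2.T5AmiceRingEquiv
open Summit.Ventures.HodgeRepro2.T5MuInvariantDVR (NormDict)
open Finset

section Limit

variable (p : ℕ) [Fact (Nat.Prime p)] (A : Type*) [NormedCommRing A]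

/-- The inverse-limit condition on a system of functions on the quotients ℤ/p^k:
`v k a = Σ_{b ↦ a} v (k+1) b`. -/
def IsCompat (v : ∀ k : ℕ, ZMod (p ^ k) → A) : Prop :=
  ∀ (k : ℕ) (a : ZMod (p ^ k)),
    v k a = ∑ b ∈ univ.filter (fun b : ZMod (p ^ (k + 1)) => (b.cast : ZMod (p ^ k)) = a), v (k + 1) b

variable {p A}

/-- Compatible systems are closed under addition. -/
theorem IsCompat.add {v w : ∀ k : ℕ, ZMod (p ^ k) → A} (hv : IsCompat p A v) (hw : IsCompat p A w) :
    IsCompat p A (v + w) := by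
  intro k a
  simp only [Pi.add_apply, Finset.sum_add_distrib]
  rw [← hv k a, ← hw k a]

/-- Compatible systems are closed under negation. -/
theorem IsCompat.neg {v : ∀ k : ℕ, ZMod (p ^ k) → A} (hv : IsCompat p A v) :
    IsCompat p A (-v) := by
  intro k a
  simp only [Pi.neg_apply, Finset.sum_neg_distrib]
  rw [← hv k a]

/-- The zero system is compatible. -/
theorem IsCompat.zero : IsCompat p A 0 := by
  intro k a
  simp

variable (p A)

/-- The bounded part of the inverse limit lim_k A[ℤ/p^k]: bounded compatible systems of values on
the residue classes, as an additive subgroup of `∀ k, ℤ/p^k → A`. -/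
def iwasawaLimit : AddSubgroup (∀ k : ℕ, ZMod (p ^ k) → A) where
  carrier := {v | IsCompat p A v ∧ ∃ C : ℝ, ∀ (k : ℕ) (a : ZMod (p ^ k)), ‖v k a‖ ≤ C}
  zero_mem' := ⟨IsCompat.zero, 0, fun k a => by simp⟩
  add_mem' := by
    rintro v w ⟨hv, C, hC⟩ ⟨hw, D, hD⟩
    refine ⟨hv.add hw, C + D, fun k a => ?_⟩
    exact (norm_add_le _ _).trans (add_le_add (hC k a) (hD k a))
  neg_mem' := by
    rintro v ⟨hv, C, hC⟩
    exact ⟨hv.neg, C, fun k a => by rw [Pi.neg_apply, Pi.neg_apply, norm_neg]; exact hC k a⟩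

variable {p A}

/-- Membership in the limit. -/
theorem mem_iwasawaLimit_iff (v : ∀ k : ℕ, ZMod (p ^ k) → A) :
    v ∈ iwasawaLimit p A ↔ IsCompat p A v ∧ ∃ C : ℝ, ∀ (k : ℕ) (a : ZMod (p ^ k)), ‖v k a‖ ≤ C :=
  Iff.rfl

/-- The values of a distribution form an element of the limit. -/
theorem Distribution.val_mem (d : Distribution p A) : d.val ∈ iwasawaLimit p A :=
  ⟨d.compat, d.bound, d.norm_le⟩

end Limit

section Equiv

variable {p : ℕ} [Fact (Nat.Prime p)]
variable {A : Type*} [NormedCommRing A]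

/-- The distribution carried by an element of the limit (bound = a chosen one). -/
noncomputable def toDist (v : iwasawaLimit p A) : Distribution p A :=
  ⟨v.1, v.2.1, Classical.choose v.2.2, Classical.choose_spec v.2.2⟩

/-- `(toDist v).val = v`. -/
@[simp] theorem toDist_val (v : iwasawaLimit p A) : (toDist v).val = (v : ∀ k : ℕ, ZMod (p ^ k) → A) :=
  rfl

/-- Two bounded measures with the same distribution coincide (bounds may differ: pass to the
larger one). -/
theorem eq_of_dist_eq' (m₁ m₂ : C(ℤ_[p], A) →ₗ[A] A) {C₁ C₂ : ℝ} (hC₁ : 0 ≤ C₁)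
    (hm₁ : ∀ φ : C(ℤ_[p], A), ‖m₁ φ‖ ≤ C₁ * ‖φ‖) (hm₂ : ∀ φ : C(ℤ_[p], A), ‖m₂ φ‖ ≤ C₂ * ‖φ‖)
    (h : dist m₁ = dist m₂) : m₁ = m₂ := by
  refine eq_of_dist_eq m₁ m₂ (C := max C₁ C₂) (le_max_of_le_left hC₁) ?_ ?_
    (fun k a => by rw [h])
  · exact fun φ => (hm₁ φ).trans (mul_le_mul_of_nonneg_right (le_max_left _ _) (norm_nonneg φ))
  · exact fun φ => (hm₂ φ).trans (mul_le_mul_of_nonneg_right (le_max_right _ _) (norm_nonneg φ))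

variable [NormOneClass A]

/-- A bounded measure, as an element of the limit: its values on the residue classes. -/
noncomputable def distB (m : BoundedMeasure p A) : iwasawaLimit p A :=
  ⟨dist (m : C(ℤ_[p], A) →ₗ[A] A), dist_compat _, by
    obtain ⟨C, hC0, hC⟩ := exists_nonneg_bound_val p A m
    exact ⟨C, norm_dist_le _ hC0 hC⟩⟩

/-- `(distB m).1 = dist m`. -/
@[simp] theorem distB_val (m : BoundedMeasure p A) :
    ((distB m : iwasawaLimit p A) : ∀ k : ℕ, ZMod (p ^ k) → A) = dist (m : C(ℤ_[p], A) →ₗ[A] A) :=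
  rfl

/-- The topological generator γ₀ = 1 ∈ ℤ_p as an element of the limit: the system
`(δ_{1 mod p^k})_k` = the group-ring element `[1]` at every level. -/
noncomputable def gamma : iwasawaLimit p A := distB (diracB p A 1)

/-- `gamma` is the point mass at `1 mod p^k` at every level. -/
theorem gamma_val (k : ℕ) (a : ZMod (p ^ k)) :
    ((gamma : iwasawaLimit p A) : ∀ k : ℕ, ZMod (p ^ k) → A) k a = if a = 1 then 1 else 0 := by
  classical
  show dist ((diracB p A 1 : BoundedMeasure p A) : C(ℤ_[p], A) →ₗ[A] A) k a = _
  rw [dist_apply]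
  change (T5AmiceDirac.dirac (1 : ℤ_[p])) _ = _
  rw [T5AmiceDirac.dirac_apply, T5MeasureSupOnClopens.indicatorCM_apply (isClopen_resClass k a),
    Set.indicator_apply, mem_resClass_iff, map_one, Pi.one_apply]
  simp only [eq_comm]

variable [IsUltrametricDist A] [CompleteSpace A]

omit [NormOneClass A] in
/-- The Riemann-sum measure of an element of the limit, as a bounded measure. -/
noncomputable def ofLimit (v : iwasawaLimit p A) : BoundedMeasure p A :=
  ⟨ofDistribution (toDist v), (toDist v).bound, norm_ofDistribution_le (toDist v)⟩

omit [NormOneClass A] in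
/-- `(ofLimit v : C(ℤ_p, A) →ₗ[A] A) = ofDistribution (toDist v)`. -/
@[simp] theorem ofLimit_val (v : iwasawaLimit p A) :
    ((ofLimit v : BoundedMeasure p A) : C(ℤ_[p], A) →ₗ[A] A) = ofDistribution (toDist v) := rfl

/-- `distB ∘ ofLimit = id`. -/
theorem distB_ofLimit (v : iwasawaLimit p A) : distB (ofLimit v) = v := by
  apply Subtype.ext
  rw [distB_val, ofLimit_val, dist_ofDistribution_eq, toDist_val]

/-- `ofLimit ∘ distB = id`. -/
theorem ofLimit_distB (m : BoundedMeasure p A) : ofLimit (distB m) = m := by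
  apply Subtype.ext
  rw [ofLimit_val]
  obtain ⟨C, hC⟩ := m.2
  exact eq_of_dist_eq' _ _ (toDist (distB m)).bound_nonneg (norm_ofDistribution_le _) hC
    (by rw [dist_ofDistribution_eq, toDist_val, distB_val])

variable [Algebra ℤ_[p] A] [IsBoundedSMul ℤ_[p] A]

/-- `distB` is additive. -/
theorem distB_add (m₁ m₂ : BoundedMeasure p A) : distB (m₁ + m₂) = distB m₁ + distB m₂ := by
  apply Subtype.ext
  funext k a
  simp only [distB_val, AddSubgroup.coe_add, Pi.add_apply, dist_apply, add_val, LinearMap.add_apply]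

/-- THE BOUNDED MEASURES ARE THE BOUNDED INVERSE LIMIT: `BoundedMeasure p A ≃+ iwasawaLimit p A`. -/
noncomputable def distAddEquiv : BoundedMeasure p A ≃+ iwasawaLimit p A where
  toFun := distB
  invFun := ofLimit
  left_inv := ofLimit_distB
  right_inv := distB_ofLimit
  map_add' := distB_add

/-- `distAddEquiv m = distB m`. -/
@[simp] theorem distAddEquiv_apply (m : BoundedMeasure p A) : distAddEquiv m = distB m := rfl

/-- THE IWASAWA ISOMORPHISM `lim_k A[ℤ/p^k] ≅ A[[T]]` (bounded parts, additively): the inverse limit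
of the group rings is the ring of bounded power series, through the measures and the Amice
transform (p401503's `amiceRingEquiv`). -/
noncomputable def iwasawaAmice : iwasawaLimit p A ≃+ boundedSeries A :=
  (distAddEquiv (p := p) (A := A)).symm.trans (amiceRingEquiv p A).toAddEquiv

/-- `iwasawaAmice v = amice (ofLimit v)`. -/
theorem iwasawaAmice_apply_coe (v : iwasawaLimit p A) :
    ((iwasawaAmice v : boundedSeries A) : PowerSeries A) =
      T5AmiceTransform.amice ((ofLimit v : BoundedMeasure p A) : C(ℤ_[p], A) →ₗ[A] A) := by
  simp only [iwasawaAmice, AddEquiv.trans_apply, RingEquiv.toAddEquiv_eq_coe,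
    RingEquiv.coe_toAddEquiv, amiceRingEquiv_apply_coe]
  rfl

/-- «γ₀ ↦ 1 + T»: the Iwasawa isomorphism sends the generator to `1 + T`
(p400809's `amice_dirac_one` through p401503). -/
theorem iwasawaAmice_gamma :
    ((iwasawaAmice (gamma : iwasawaLimit p A) : boundedSeries A) : PowerSeries A) =
      1 + PowerSeries.X := by
  rw [gamma, iwasawaAmice, AddEquiv.trans_apply]
  show ((amiceRingEquiv p A) (distAddEquiv.symm (distAddEquiv (diracB p A 1))) : PowerSeries A) = _
  rw [AddEquiv.symm_apply_apply]
  exact amiceRingEquiv_diracB_one p A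

end Equiv

section DVR

variable {p : ℕ} [Fact (Nat.Prime p)]
variable {A : Type*} [NormedCommRing A] [IsDomain A] [IsDiscreteValuationRing A]

/-- Under the norm / valuation dictionary every compatible system is bounded (by 1). -/
theorem mem_iwasawaLimit_iff_of_normDict {r : ℝ} (hd : NormDict A r)
    (v : ∀ k : ℕ, ZMod (p ^ k) → A) : v ∈ iwasawaLimit p A ↔ IsCompat p A v :=
  ⟨fun h => h.1, fun h => ⟨h, 1, fun _ _ => hd.norm_le_one _⟩⟩

variable [IsUltrametricDist A]

/-- Under the dictionary every power series has bounded coefficients. -/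
theorem boundedSeries_eq_top_of_normDict {r : ℝ} (hd : NormDict A r) :
    boundedSeries A = ⊤ := by
  ext f
  simp only [Subring.mem_top, iff_true]
  exact (mem_boundedSeries_iff A f).2 ⟨1, fun n => hd.norm_le_one _⟩

variable [Algebra ℤ_[p] A] [IsBoundedSMul ℤ_[p] A] [CompleteSpace A] [NormOneClass A]

/-- «W[[Γ_𝔭]] ≅ W[[T]]» FOR A DISCRETE VALUATION RING W WITH ITS VALUATION NORM, the group ring
side being the inverse limit lim_k W[ℤ/p^k] as printed: `iwasawaLimit p A ≃+ PowerSeries A`. -/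
noncomputable def iwasawaAmiceDVR {r : ℝ} (hd : NormDict A r) :
    iwasawaLimit p A ≃+ PowerSeries A :=
  ((iwasawaAmice (p := p) (A := A)).trans
    (RingEquiv.subringCongr (boundedSeries_eq_top_of_normDict hd)).toAddEquiv).trans
    Subring.topEquiv.toAddEquiv

/-- `iwasawaAmiceDVR hd v = amice (ofLimit v)`. -/
theorem iwasawaAmiceDVR_apply {r : ℝ} (hd : NormDict A r) (v : iwasawaLimit p A) :
    iwasawaAmiceDVR hd v =
      T5AmiceTransform.amice ((ofLimit v : BoundedMeasure p A) : C(ℤ_[p], A) →ₗ[A] A) := by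
  rw [← iwasawaAmice_apply_coe]
  rfl

/-- «γ₀ ↦ 1 + T» over a discrete valuation ring. -/
theorem iwasawaAmiceDVR_gamma {r : ℝ} (hd : NormDict A r) :
    iwasawaAmiceDVR hd (gamma : iwasawaLimit p A) = 1 + PowerSeries.X := by
  rw [← iwasawaAmice_gamma (p := p) (A := A)]
  rfl

end DVR

end Summit.Ventures.HodgeRepro2.T5IwasawaLimit
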